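/-
Origin: expansion seat `planner-pub-hodgecm-mc-axioms-1-g14-0`, handover #W67 2026-08-20T15:53:55Z md5 81062af2a0df (PKG 73bdd33e1453 → 81062af2a0df; 114 l.; MECHANICAL (iib-R) rewrite v3.1 of the PKG file as it stands (92 token edits; rules R1x1+RX[h₂]x91)) (`HOME/mc/pub-hodgecm-mc-axioms-1-g14/revendor/kit-r55/stage55/HodgeCM/Model/E2InstanceR16AK.lean`, md5 81062af2a0df, 114 lines);
landed by the gen-22 packager (p-g22) in gate run 55 REPLACES the earlier landed copy of `HodgeCM/Model/E2InstanceR16AK.lean` (seat copy carried the packager Origin header of an earlier run (stripped)).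
-/
/-
Origin: CONSTRUCTION seat `planner-pub-hodgecm-mc-glue-1-g5-0` (unit pub-hodgecm-mc-glue-1-g5, gen 5 of mc-glue-1,
node E ASSEMBLER), 2026-08-19.  NEW additive leaf `HodgeCM/Model/E2InstanceR16AK.lean` = the END-STATE COROLLARY of
E revision 16A (carver rulings model1-g5 (G1-A/E-K)(b) 2026-08-19T06:00:35Z, model2-g5 (LLL′)(2) 06:04:42Z).
Imports: `HodgeCM.Model.UniverseKernel` (mc-period-1-g5 t35 #1095 — `Model.hHD_holds` / `Model.hI_holds` /
`Model.picardCMUniverseK`, over the V-betti twins #103 / #521 / #1081) and `HodgeCM.Model.E2InstanceR16A` (the GENERAL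
theorem of record `Model.perL_picardCM_r16A`).  INSTALL ORDER: after #1095 and after `E2InstanceR16A` ″ (v2 joint-cut member).
Bounce-isolated: nothing imports this file; if #1095 or its G-kernel cone is absent the leaf is DROPPED ALONE and
`Model.perL_picardCM_r16A` stays the headline.  KERNEL only: 1 theorem, 0 defs, no proof holes; expected
`#print axioms` = {propext, Classical.choice, Quot.sound}.  No cite records.
v2 member: built over the v2 `ThetaSpaceInputPin` joint cut (parent = the ″ re-cut of `E2InstanceR16A`).
-/
import Summits.HodgeConjecture.HodgeCM.Model.UniverseKernel
import Summits.HodgeConjecture.HodgeCM.Model.E2InstanceR16A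

/-!
# E2 instance, revision 16A — END-STATE COROLLARY over the three cited records only

`Model.perL_picardCM_r16A` (the theorem of record, kept GENERAL) is stated over the section parameters
`hHD : exists_isReal_hodgeModel` (R-HD) and `hI : hodgePQ_independent_of_hodgeModel` (R-I) of the universe term
`picardCMUniverse hHD hI h₁ h₃`.  Both rows are THEOREMS of the hub tree (`exists_isReal_hodgeModel_holds`,
`hodgePQ_independent_of_hodgeModel_holds`; PKG twins t35 #103 / #521), re-exported by `Model/UniverseKernel.lean`
as `Model.hHD_holds` / `Model.hI_holds`, with the `abbrev`
`Model.picardCMUniverseK h₁ h₃ := picardCMUniverse hHD_holds hI_holds h₁ h₃` (`picardCMUniverseK_eq : … = … := rfl`).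

This leaf is the ONE-LINE SPECIALISATION (G1 reading A):

* `Model.perL_picardCMK_r16A` : `(picardCMUniverseK h₁ h₃).PerL` under revision 16A's binders VERBATIM with
  `hHD hI` ↦ `hHD_holds hI_holds` (16 binders: `h`, `hA`, `W`, `S`, `μ`, `hBetti`, `hR`, `hLiu`, `C`, `hT`, `hpd`, `hk`, `gen12`, `real34`, `hyp12`, `hyp34`);
  proof = `perL_picardCM_r16A hHD_holds hI_holds h₁ h₃ h …` (`rfl` on the universe).

`hHD` / `hI` were universe PARAMETERS, never E binders, so no E binder drops here; the universe of the conclusion now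
depends on the three cited records `h₁ : BallQuotientUniformised`, `h₂ : SpecialCyclesAlgebraic`,
`h₃ : CMAbelianVarietyRealised` only.  The `_r16As` / `_r16Acore` variants are not specialised (optional per the ruling).
-/

noncomputable section

open scoped TensorProduct InnerProductSpace Matrix

namespace HodgeCM

namespace Model

open HodgeCM.Universe (AdelicThetaCore AdelicThetaCore₀ SideData ThetaModel ModelAxiomsPerL)
open Literature.AlgebraicGeometry.HodgeTheory
open Literature.AlgebraicGeometry.ComplexMultiplication (Shimura1998_Thm3_isogenousPower Shimura1998_Thm2_Cor)
open Literature.NumberTheory.Automorphic.PicardCM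
open Literature.NumberTheory.Transcendental (Arapura2012_Cor_15_4_6)
open HodgeCM.CMTypeOps (inflate)
open HodgeCM.Model.SupplyResidual (ClassSupplyPackN)
open HodgeCM.Model.ThetaSpace

variable (h₁ : BallQuotientUniformised)  (h₃ : CMAbelianVarietyRealised)

/-- **E2 instance, revision 16A — END-STATE COROLLARY (G1 reading A).** `Model.perL_picardCM_r16A` at the KERNEL
witnesses `Model.hHD_holds` (R-HD) / `Model.hI_holds` (R-I) of the universe parameters: the conclusion is `PerL` for
`Model.picardCMUniverseK h₁ h₃`, the Picard–CM model universe over the three cited records only.  Binders = revision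
16A's verbatim under `hHD hI` ↦ `hHD_holds hI_holds`. -/
theorem perL_picardCMK_r16A (h : Bool)
    (hA : Arapura2012_Cor_15_4_6)
    (W : ∀ {L : CMField} {ι₁ : L →+* ℂ} (V : HermSpace3 L ι₁) (c : SeesawCtx L), WmInput V c.D)
    (S : ∀ {L : CMField} {ι₁ : L →+* ℂ} (V : HermSpace3 L ι₁) (c : SeesawCtx L), ThetaAdelicSide V c)
    (μ : ∀ {L : CMField}, SeesawCtx L → Fin 4 → NumberField.InfinitePlace L → ℤ)
    (hBetti : ∀ {L : CMField} {ι₁ : L →+* ℂ} (V : HermSpace3 L ι₁), EmbBettiSide hHD_holds hI_holds h₁ h₃ V)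
    (hR : DeligneMilne1982_Thm_6_20_full)
    (hLiu : ∀ {L : CMField} {ι₁ : L →+* ℂ} (V : HermSpace3 L ι₁) (c : SeesawCtx L),
      (thetaModelOf hHD_holds hI_holds h₁ h₃ h (embOf hHD_holds hI_holds h₁ h₃) (coverOf hHD_holds hI_holds h₁ h₃ hA) (wmOfInput W) (thetaOf _ (thetaClassInputOf _ (fun V c => thetaSpaceInputOf hHD_holds hI_holds h₁ h₃ S V c))) (d12Of μ) (d34Of μ)).GoodCtx ι₁ c → Module.finrank ℚ c.K = 6 →
      ∀ (i : Fin 4) (Γ : Level V), ∃ (M : CMField) (k : c.K →+* M) (σ' : M →+* ℂ), σ'.comp k = c.σ ∧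
        (thetaModelOf hHD_holds hI_holds h₁ h₃ h (embOf hHD_holds hI_holds h₁ h₃) (coverOf hHD_holds hI_holds h₁ h₃ hA) (wmOfInput W) (thetaOf _ (thetaClassInputOf _ (fun V c => thetaSpaceInputOf hHD_holds hI_holds h₁ h₃ S V c))) (d12Of μ) (d34Of μ)).Theta V c i Γ ⊆
          (picardCMUniverse hHD_holds hI_holds h₁ h₃).Uiso Γ M (inflate k (c.Ψ i)) σ')
    (C : ∀ {L : CMField} {ι₁ : L →+* ℂ} (V : HermSpace3 L ι₁) (c : SeesawCtx L) (hV : IsAnisotropic L V.Hm),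
      (thetaModelOf hHD_holds hI_holds h₁ h₃ h (embOf hHD_holds hI_holds h₁ h₃) (coverOf hHD_holds hI_holds h₁ h₃ hA) (wmOfInput W) (thetaOf _ (thetaClassInputOf _ (fun V c => thetaSpaceInputOf hHD_holds hI_holds h₁ h₃ S V c))) (d12Of μ) (d34Of μ)).GoodCtx ι₁ c →
      Module.finrank ℚ c.K = 6 → ∀ k : Fin 4, k = 0 ∨ k = 1 → ∀ N : ℕ, 0 < N →
        ArchKTypeData (thetaSpaceInputIn hHD_holds hI_holds h₁ h₃ (S V c) hV) k N)
    (hT : ∀ {L : CMField} {ι₁ : L →+* ℂ} (V : HermSpace3 L ι₁) (c : SeesawCtx L) (k : Fin 4) (N : ℕ),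
      ((S V c).P k).IsThetaArchContinuous N)
    (hpd : ∀ {L : CMField} {ι₁ : L →+* ℂ} (V : HermSpace3 L ι₁) (c : SeesawCtx L) (hV : IsAnisotropic L V.Hm)
      (hc : (thetaModelOf hHD_holds hI_holds h₁ h₃ h (embOf hHD_holds hI_holds h₁ h₃) (coverOf hHD_holds hI_holds h₁ h₃ hA) (wmOfInput W) (thetaOf _ (thetaClassInputOf _ (fun V c => thetaSpaceInputOf hHD_holds hI_holds h₁ h₃ S V c))) (d12Of μ) (d34Of μ)).GoodCtx ι₁ c)
      (h6 : Module.finrank ℚ c.K = 6) (k : Fin 4) (hk : k = 0 ∨ k = 1) (N : ℕ) (hN : 0 < N),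
      (C V c hV hc h6 k hk N hN).IsWeaklyPDiff Literature.AlgebraicGeometry.ShimuraVarieties.BallForms.expP)
    (hk : ∀ {L : CMField} {ι₁ : L →+* ℂ} (V : HermSpace3 L ι₁) (c : SeesawCtx L) (hV : IsAnisotropic L V.Hm)
      (hc : (thetaModelOf hHD_holds hI_holds h₁ h₃ h (embOf hHD_holds hI_holds h₁ h₃) (coverOf hHD_holds hI_holds h₁ h₃ hA) (wmOfInput W) (thetaOf _ (thetaClassInputOf _ (fun V c => thetaSpaceInputOf hHD_holds hI_holds h₁ h₃ S V c))) (d12Of μ) (d34Of μ)).GoodCtx ι₁ c)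
      (h6 : Module.finrank ℚ c.K = 6) (k : Fin 4) (hk : k = 0 ∨ k = 1) (N : ℕ) (hN : 0 < N),
      (C V c hV hc h6 k hk N hN).IsPMinusKilled Literature.AlgebraicGeometry.ShimuraVarieties.BallForms.expP)
    (gen12 : ∀ {L : CMField} {ι₁ : L →+* ℂ} (V : HermSpace3 L ι₁) (c : SeesawCtx L),
      (thetaModelOf hHD_holds hI_holds h₁ h₃ h (embOf hHD_holds hI_holds h₁ h₃) (coverOf hHD_holds hI_holds h₁ h₃ hA) (wmOfInput W) (thetaOf _ (thetaClassInputOf _ (fun V c => thetaSpaceInputOf hHD_holds hI_holds h₁ h₃ S V c))) (d12Of μ) (d34Of μ)).GoodCtx ι₁ c → Module.finrank ℚ c.K = 6 →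
      Nonempty ((thetaModelOf hHD_holds hI_holds h₁ h₃ h (embOf hHD_holds hI_holds h₁ h₃) (coverOf hHD_holds hI_holds h₁ h₃ hA) (wmOfInput W) (thetaOf _ (thetaClassInputOf _ (fun V c => thetaSpaceInputOf hHD_holds hI_holds h₁ h₃ S V c))) (d12Of μ) (d34Of μ)).Gen12FunBridge V c))
    (real34 : ∀ {L : CMField} {ι₁ : L →+* ℂ} (V : HermSpace3 L ι₁) (c : SeesawCtx L),
      (thetaModelOf hHD_holds hI_holds h₁ h₃ h (embOf hHD_holds hI_holds h₁ h₃) (coverOf hHD_holds hI_holds h₁ h₃ hA) (wmOfInput W) (thetaOf _ (thetaClassInputOf _ (fun V c => thetaSpaceInputOf hHD_holds hI_holds h₁ h₃ S V c))) (d12Of μ) (d34Of μ)).GoodCtx ι₁ c → Module.finrank ℚ c.K = 6 →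
      Nonempty ((thetaModelOf hHD_holds hI_holds h₁ h₃ h (embOf hHD_holds hI_holds h₁ h₃) (coverOf hHD_holds hI_holds h₁ h₃ hA) (wmOfInput W) (thetaOf _ (thetaClassInputOf _ (fun V c => thetaSpaceInputOf hHD_holds hI_holds h₁ h₃ S V c))) (d12Of μ) (d34Of μ)).Real34FunBridge V c))
    (hyp12 : ∀ {L : CMField} {ι₁ : L →+* ℂ} (V : HermSpace3 L ι₁) (c : SeesawCtx L),
      (thetaModelOf hHD_holds hI_holds h₁ h₃ h (embOf hHD_holds hI_holds h₁ h₃) (coverOf hHD_holds hI_holds h₁ h₃ hA) (wmOfInput W) (thetaOf _ (thetaClassInputOf _ (fun V c => thetaSpaceInputOf hHD_holds hI_holds h₁ h₃ S V c))) (d12Of μ) (d34Of μ)).GoodCtx ι₁ c → Module.finrank ℚ c.K = 6 →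
      Nonempty (((coreOf _ (embOf hHD_holds hI_holds h₁ h₃) (coverOf hHD_holds hI_holds h₁ h₃ hA) (wmOfInput W) (thetaOf _ (thetaClassInputOf _ (fun V c => thetaSpaceInputOf hHD_holds hI_holds h₁ h₃ S V c)))).toCore h).HypSmoothCore12
        (((coreOf _ (embOf hHD_holds hI_holds h₁ h₃) (coverOf hHD_holds hI_holds h₁ h₃ hA) (wmOfInput W) (thetaOf _ (thetaClassInputOf _ (fun V c => thetaSpaceInputOf hHD_holds hI_holds h₁ h₃ S V c)))).toCore h).side12 (d12Of μ)) (((coreOf _ (embOf hHD_holds hI_holds h₁ h₃) (coverOf hHD_holds hI_holds h₁ h₃ hA) (wmOfInput W) (thetaOf _ (thetaClassInputOf _ (fun V c => thetaSpaceInputOf hHD_holds hI_holds h₁ h₃ S V c)))).toCore h).side34 (d34Of μ))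
        ((((coreOf _ (embOf hHD_holds hI_holds h₁ h₃) (coverOf hHD_holds hI_holds h₁ h₃ hA) (wmOfInput W) (thetaOf _ (thetaClassInputOf _ (fun V c => thetaSpaceInputOf hHD_holds hI_holds h₁ h₃ S V c)))).toCore h).analyticKM (((coreOf _ (embOf hHD_holds hI_holds h₁ h₃) (coverOf hHD_holds hI_holds h₁ h₃ hA) (wmOfInput W) (thetaOf _ (thetaClassInputOf _ (fun V c => thetaSpaceInputOf hHD_holds hI_holds h₁ h₃ S V c)))).toCore h).side12 (d12Of μ))
          (((coreOf _ (embOf hHD_holds hI_holds h₁ h₃) (coverOf hHD_holds hI_holds h₁ h₃ hA) (wmOfInput W) (thetaOf _ (thetaClassInputOf _ (fun V c => thetaSpaceInputOf hHD_holds hI_holds h₁ h₃ S V c)))).toCore h).side34 (d34Of μ))).toAnalytic) V c (ℓ := linOfInput W V c)))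
    (hyp34 : ∀ {L : CMField} {ι₁ : L →+* ℂ} (V : HermSpace3 L ι₁) (c : SeesawCtx L),
      (thetaModelOf hHD_holds hI_holds h₁ h₃ h (embOf hHD_holds hI_holds h₁ h₃) (coverOf hHD_holds hI_holds h₁ h₃ hA) (wmOfInput W) (thetaOf _ (thetaClassInputOf _ (fun V c => thetaSpaceInputOf hHD_holds hI_holds h₁ h₃ S V c))) (d12Of μ) (d34Of μ)).GoodCtx ι₁ c → Module.finrank ℚ c.K = 6 →
      Nonempty (((coreOf _ (embOf hHD_holds hI_holds h₁ h₃) (coverOf hHD_holds hI_holds h₁ h₃ hA) (wmOfInput W) (thetaOf _ (thetaClassInputOf _ (fun V c => thetaSpaceInputOf hHD_holds hI_holds h₁ h₃ S V c)))).toCore h).HypSmoothCore34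
        (((coreOf _ (embOf hHD_holds hI_holds h₁ h₃) (coverOf hHD_holds hI_holds h₁ h₃ hA) (wmOfInput W) (thetaOf _ (thetaClassInputOf _ (fun V c => thetaSpaceInputOf hHD_holds hI_holds h₁ h₃ S V c)))).toCore h).side12 (d12Of μ)) (((coreOf _ (embOf hHD_holds hI_holds h₁ h₃) (coverOf hHD_holds hI_holds h₁ h₃ hA) (wmOfInput W) (thetaOf _ (thetaClassInputOf _ (fun V c => thetaSpaceInputOf hHD_holds hI_holds h₁ h₃ S V c)))).toCore h).side34 (d34Of μ))
        ((((coreOf _ (embOf hHD_holds hI_holds h₁ h₃) (coverOf hHD_holds hI_holds h₁ h₃ hA) (wmOfInput W) (thetaOf _ (thetaClassInputOf _ (fun V c => thetaSpaceInputOf hHD_holds hI_holds h₁ h₃ S V c)))).toCore h).analyticKM (((coreOf _ (embOf hHD_holds hI_holds h₁ h₃) (coverOf hHD_holds hI_holds h₁ h₃ hA) (wmOfInput W) (thetaOf _ (thetaClassInputOf _ (fun V c => thetaSpaceInputOf hHD_holds hI_holds h₁ h₃ S V c)))).toCore h).side12 (d12Of μ))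
          (((coreOf _ (embOf hHD_holds hI_holds h₁ h₃) (coverOf hHD_holds hI_holds h₁ h₃ hA) (wmOfInput W) (thetaOf _ (thetaClassInputOf _ (fun V c => thetaSpaceInputOf hHD_holds hI_holds h₁ h₃ S V c)))).toCore h).side34 (d34Of μ))).toAnalytic) V c (ℓ := linOfInput W V c))) :
     (picardCMUniverseK h₁ h₃).PerL :=
  perL_picardCM_r16A hHD_holds hI_holds h₁ h₃ h
    hA W S μ hBetti hR hLiu C hT hpd hk gen12 real34 hyp12 hyp34

end Model

end HodgeCM
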